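import Summits.CriticalPhenomena.PercolationContinuityZ3.Theorems.PercNearOneGluingNoHeavyLowerTailSahiThreeCopyCellSlotFamilies2

/-!
# `NoHeavyLowerTail` (crux stmt-CriticalPhenomena-4575), Sahi programme: the slot `T₆ = (x₀∨x₁∨x₂)(x₃∨x₄∨x₅)` (two triples)

Support file (Sahi cell, seat `prim-sahi-p1`, generation 65; `--supports stmt-CriticalPhenomena-4575`).  Definitions only: predicate, `Finset`, integer
indicator, blocks, `setInd_…_eq`, up-set lemma (boundary profiles are free on six coordinates). [this work]
-/

namespace Summit.CriticalPhenomena.PercolationContinuityZ3.Theorems.SahiThreeCopy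

open Finset Function Literature.Combinatorics.Sahi2008
open scoped BigOperators

/-- `(x₀∨x₁∨x₂) ∧ (x₃∨x₄∨x₅)`. [this work] -/
def t6B (e : Pt 6) : Bool := (e 0 || e 1 || e 2) && (e 3 || e 4 || e 5)

/-- The slot `T₆` as a `Finset`. [this work] -/
def T6Set : Finset (Pt 6) := univ.filter fun e => t6B e = true

/-- Integer indicator of `T₆`. [this work] -/
def t6Z (e : Pt 6) : ℤ := if t6B e then 1 else 0

/-- Blocks of `T₆`: two triples. [this work] -/
def blocksT6 : List (List (Fin 6)) := [[0, 1, 2], [3, 4, 5]]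

/-- `setInd T6Set` is the real cast of the integer indicator. [this work] -/
theorem setInd_T6Set_eq : setInd T6Set = fun x => (t6Z x : ℝ) := by
  funext x; rw [T6Set, setInd_filter_eq]; unfold t6Z; split_ifs <;> simp

/-- `T₆` is an up-set. [this work] -/
theorem isUpperSet_T6Set : IsUpperSet ((T6Set : Finset (Pt 6)) : Set (Pt 6)) := by
  refine isUpperSet_filter_bool fun x y hxy hx => ?_
  simp only [t6B, Bool.and_eq_true] at hx ⊢
  exact ⟨or3_mono_bool (hxy 0) (hxy 1) (hxy 2) hx.1, or3_mono_bool (hxy 3) (hxy 4) (hxy 5) hx.2⟩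

end Summit.CriticalPhenomena.PercolationContinuityZ3.Theorems.SahiThreeCopy
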